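import Literature.MathematicalPhysics.QuantumFieldTheory.Balaban1983to89.Node00.Record12
import Literature.MathematicalPhysics.QuantumFieldTheory.Balaban1983to89.Node00.Record11CarriersB8Sub

/-!
# NODE 00 (YM-PLAN Track A) — THE SEVEN CARRIER PINS RESTATED AT def-T's STAGE 12 (`Record12`: the repaired §2 [III] format pins, the 𝐓-weights of record per run,
# the THEOREM-backed level-0 background — R457's repair lane): `Stage12Params.pinB10 ∕ pinY ∕ pinZ ∕ pinW ∕ pinB8 ∕ pinB8Sub ∕ pinB12`, the views
# `view₁₂B10YZW ∕ view₁₂B8B10YZW ∕ view₁₂B12B8B10YZW ∕ view₁₂B8subB10YZW ∕ view₁₂B12B8subB10YZW` and their leaves BY NAME; the record predicates are the sequels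
# `Node00/Record12CarriersRecords` (`IsRecordOfRecord₁₂CB10YZW → ₁₂C`, `…B8`) and `Node00/Record12CarriersB12` (`…B8B12`, `…B8subB12`)

NODE 00 RECORD MODULE (seat `pub-ymgap-node00-def` g32, 2026-08-26; director-ym R134 (c) trigger t4 «`Record12Carriers` pre-emptively»; lead R457 (C) ∕ director LINE №81–№88: the
four cruxes re-key at ₁₂ once def-T's 12b `Record12` lands — the carrier-pinned predicates must exist the same hour).  The ONE-module restate of g31's `Record11Carriers` §1 +
g32's `Record11CarriersB12` §2 ∕ `Record11CarriersB8Sub` §2 with `11 ↦ 12`: def-T's `Stage12Params` EXTENDS `Stage9Params` exactly as `Stage11Params` did (WORD-12b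
readings (i)–(iii) all hold: the pins lift as `{ θ with toStage9Params := θ.toStage9Params.pin<G> … }`; `toStage5₁₂ = {toStage5Params with res := residualOfStage12}` keeps
`X ∕ Y ∕ Z ∕ W`; `Provisos₁₂`'s fields read no carrier).  APPEND-ONLY: a NEW importing module; `Record12` and every module below it
untouched and CONSUMED BY NAME.  [Balaban1988Convergent] = Commun. Math. Phys. **119** (1988) 243–285; [Balaban1989LargeFieldII] = Commun. Math. Phys. **122** (1989) 355–392.

WHAT IS DEFINED ∕ PROVED (kernel bookkeeping, 0 sorry): the seven pins on `Stage12Params` (`…_admissible_iff` `Iff.rfl` ×7), the generic device `Stage12Params.rebindX`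
(over g32's `Stage9Params.rebindX`) with `toStage5₁₂_rebindX : rfl`, `Provisos₁₂.rebindX` (field by field), `datumOfRecord₁₂_rebindX : rfl` — the [B10], [B8], [B8′],
[B12] pins are its instances; `toStage5₁₂_pin<G>` (`rfl`), `Provisos₁₂.pin<G>`, **`datumOfRecord₁₂_pin<G> : rfl` (ALL PINS UP-SIDE)**; `WOfRecord₁₂ θ := WOfRecord₁₀
θ.toStage9Params` (+ `rfl` under the pins); `F12OfRecord₁₂ ∕ B12LeafOfRecord₁₂` (the [B12] frame ∕ leaf at a Stage-12 parameter; `F12OfRecord₁₂_toStage11 : rfl` = the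
SAME objects the Stage-11 view `θ.toStage11 p′` carries, so every ₁₁ consumer re-instantiates by `rfl`), `XB12OfRecord₁₂`; the five views and their leaves (`b8`, `b12` by
`Iff.rfl`; the rest by g29–g31's Stage-5 faces `upOfRecord₅C_pinW_b9_b10_b11`, `…_pinZ_b9 ∕ _b10 ∕ _b11_iff`, `…_pinY_b9_iff ∕ _b10`, `…_pinB10_b10_iff`,
`…_pinW_rBasicStep_iff`).  HONEST FRAMING: definitions + kernel bookkeeping; NO estimate; nothing of Bałaban's asserted; no node discharged; counts unmoved (5∕28); one finite
T⁴ programme at fixed ε — NOT continuum ∕ ℝ⁴ ∕ infinite volume ∕ OS ∕ mass gap ∕ Clay.  No `sorry`, no `axiom`, no `opaque`, no `instance`, no `notation`. -/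

noncomputable section

namespace Literature.MathematicalPhysics.QuantumFieldTheory.Balaban1983to89.Node00

open T4Continuum AveragingRT T4FiniteEpsInhabited FlowStep FlowStepRuns DagBinding T4DatumAssembly
open B8LeafKnitRS (B8LeafRS)
open scoped Matrix.Norms.L2Operator

/-! ## §1. The seven pins lift to Stage-12 parameters and pass through the Stage-12 view, provisos and datum -/

section Pins

variable (F : T4Family) (N : ℕ) [NeZero N]

/-- The [B10] pin of Stage-12 parameters (lifted through `toStage9Params`; the §2-form data untouched). [cite: Balaban1985UV3, (1)–(5) p.256 (bookkeeping)] -/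
def Stage12Params.pinB10 (θ : Stage12Params F N) : Stage12Params F N := { θ with toStage9Params := θ.toStage9Params.pinB10 F N }

/-- The Y pin of Stage-12 parameters. [cite: Balaban1985BackgroundPropagators, Thm 3.1 p.397 (bookkeeping)] -/
def Stage12Params.pinY (θ : Stage12Params F N) (Y₀ : PrintedCarriers9X) : Stage12Params F N := { θ with toStage9Params := θ.toStage9Params.pinY F N Y₀ }

/-- The Z pin of Stage-12 parameters. [cite: Balaban1985Variational, Thm 1 p.279 (bookkeeping)] -/
def Stage12Params.pinZ (θ : Stage12Params F N) (Z₀ : PrintedCarriers11) : Stage12Params F N := { θ with toStage9Params := θ.toStage9Params.pinZ F N Z₀ }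

/-- The W pin of Stage-12 parameters. [cite: Balaban1989LargeFieldI, (0.2) p.176 (bookkeeping)] -/
def Stage12Params.pinW (θ : Stage12Params F N) (W₀ : B12.RunParams → PrintedCarriers15) : Stage12Params F N :=
  { θ with toStage9Params := θ.toStage9Params.pinW F N W₀ }

/-- The [B8] pin of Stage-12 parameters. [cite: Balaban1985RegularSpaces, Thm 2 p.83 (bookkeeping)] -/
def Stage12Params.pinB8 (θ : Stage12Params F N) (lam : ResidB8 θ.toStage3Params) : Stage12Params F N :=
  { θ with toStage9Params := θ.toStage9Params.pinB8 F N lam }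

/-- Admissibility is unchanged by the [B10] pin (`Iff.rfl`). [cite: Balaban1987RG1, (1.20)–(1.21) p.264 (hypothesis dictionary; bookkeeping)] -/
theorem Stage12Params.pinB10_admissible_iff (θ : Stage12Params F N) : (θ.pinB10 F N).Admissible F N ↔ θ.Admissible F N := Iff.rfl

/-- … by the Y pin … [cite: Balaban1987RG1, (1.20)–(1.21) p.264 (bookkeeping)] -/
theorem Stage12Params.pinY_admissible_iff (θ : Stage12Params F N) (Y₀ : PrintedCarriers9X) : (θ.pinY F N Y₀).Admissible F N ↔ θ.Admissible F N := Iff.rfl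

/-- … by the Z pin … [cite: Balaban1987RG1, (1.20)–(1.21) p.264 (bookkeeping)] -/
theorem Stage12Params.pinZ_admissible_iff (θ : Stage12Params F N) (Z₀ : PrintedCarriers11) : (θ.pinZ F N Z₀).Admissible F N ↔ θ.Admissible F N := Iff.rfl

/-- … by the W pin … [cite: Balaban1987RG1, (1.20)–(1.21) p.264 (bookkeeping)] -/
theorem Stage12Params.pinW_admissible_iff (θ : Stage12Params F N) (W₀ : B12.RunParams → PrintedCarriers15) : (θ.pinW F N W₀).Admissible F N ↔ θ.Admissible F N :=
  Iff.rfl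

/-- … and by the [B8] pin. [cite: Balaban1987RG1, (1.20)–(1.21) p.264 (bookkeeping)] -/
theorem Stage12Params.pinB8_admissible_iff (θ : Stage12Params F N) (lam : ResidB8 θ.toStage3Params) : (θ.pinB8 F N lam).Admissible F N ↔ θ.Admissible F N := Iff.rfl

/-- Plumbing: Stage-12 parameters with the run-indexed carrier bundle `X` RE-BOUND to `X'` (every other field verbatim) — the common shape of the [B10], [B8], [B8′]
and [B12] pins (g32's `Stage9Params.rebindX` underneath), through which the datum lemmas below are stated once (a generic `X'` makes the kernel's «pinned ≠ unpinned» check immediate). [folklore] -/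
def Stage12Params.rebindX (θ : Stage12Params F N) (X' : B12.RunParams → PrintedCarriersR) : Stage12Params F N :=
  { θ with toStage9Params := θ.toStage9Params.rebindX F N X' }

/-- The Stage-12 view commutes with re-binding `X` (`rfl`, once, at a generic re-binding: `residualOfStage12` keeps `X`). [cite: Balaban1988Convergent, p.244 (bookkeeping)] -/
theorem Stage12Params.toStage5₁₂_rebindX (θ : Stage12Params F N) (X' : B12.RunParams → PrintedCarriersR) :
    (θ.rebindX F N X').toStage5₁₂ F N = (θ.toStage5₁₂ F N).rebindX F N X' := rfl

/-- The Stage-12 view of [B10]-pinned parameters IS the [B10]-pinned Stage-12 view (`rfl`: `residualOfStage12` keeps `X`). [cite: Balaban1985UV3, (1)–(5) p.256 (bookkeeping)] -/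
theorem Stage12Params.toStage5₁₂_pinB10 (θ : Stage12Params F N) : (θ.pinB10 F N).toStage5₁₂ F N = (θ.toStage5₁₂ F N).pinB10 F N :=
  Stage12Params.toStage5₁₂_rebindX F N θ _

/-- … Y (`rfl`) … [cite: Balaban1985BackgroundPropagators, Thm 3.1 p.397 (bookkeeping)] -/
theorem Stage12Params.toStage5₁₂_pinY (θ : Stage12Params F N) (Y₀ : PrintedCarriers9X) : (θ.pinY F N Y₀).toStage5₁₂ F N = (θ.toStage5₁₂ F N).pinY F N Y₀ := rfl

/-- … Z (`rfl`) … [cite: Balaban1985Variational, Thm 1 p.279 (bookkeeping)] -/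
theorem Stage12Params.toStage5₁₂_pinZ (θ : Stage12Params F N) (Z₀ : PrintedCarriers11) : (θ.pinZ F N Z₀).toStage5₁₂ F N = (θ.toStage5₁₂ F N).pinZ F N Z₀ := rfl

/-- … W (`rfl`) … [cite: Balaban1989LargeFieldI, (0.2) p.176 (bookkeeping)] -/
theorem Stage12Params.toStage5₁₂_pinW (θ : Stage12Params F N) (W₀ : B12.RunParams → PrintedCarriers15) :
    (θ.pinW F N W₀).toStage5₁₂ F N = (θ.toStage5₁₂ F N).pinW F N W₀ := rfl

/-- … and [B8] (`rfl`). [cite: Balaban1985RegularSpaces, Thm 2 p.83 (bookkeeping)] -/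
theorem Stage12Params.toStage5₁₂_pinB8 (θ : Stage12Params F N) (lam : ResidB8 θ.toStage3Params) :
    (θ.pinB8 F N lam).toStage5₁₂ F N = (θ.toStage5₁₂ F N).pinB8 F N lam :=
  Stage12Params.toStage5₁₂_rebindX F N θ _

/-- The [IV] bundle of record at ₁₂ is ₁₀'s at `toStage9Params` (β, histories and the tower of record are `Record10`'s); it does not read the pinned fields (`rfl` ×2 below).
[cite: Balaban1989LargeFieldI, (0.2)–(0.6) p.176 (bookkeeping)] -/
def WOfRecord₁₂ (θ : Stage12Params F N) (lam : ResidW F N) (P : B12.RunParams) : PrintedCarriers15 := WOfRecord₁₀ F N θ.toStage9Params lam P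

/-- `WOfRecord₁₂ (θ.pinW W₀) = WOfRecord₁₂ θ` (`rfl`). [cite: Balaban1989LargeFieldI, (0.2) p.176 (bookkeeping)] -/
theorem WOfRecord₁₂_pinW (θ : Stage12Params F N) (W₀ : B12.RunParams → PrintedCarriers15) (lam : ResidW F N) :
    WOfRecord₁₂ F N (θ.pinW F N W₀) lam = WOfRecord₁₂ F N θ lam := rfl

/-- `WOfRecord₁₂ (θ.pinB8 lam8) = WOfRecord₁₂ θ` (`rfl`). [cite: Balaban1989LargeFieldI, (0.2) p.176 (bookkeeping)] -/
theorem WOfRecord₁₂_pinB8 (θ : Stage12Params F N) (lam8 : ResidB8 θ.toStage3Params) (lam : ResidW F N) :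
    WOfRecord₁₂ F N (θ.pinB8 F N lam8) lam = WOfRecord₁₂ F N θ lam := rfl

variable {F N}

/-- The Stage-12 provisos read no carrier: they transport along ANY `X`-re-binding (structure update: `base` by g32's `Provisos₁₀.rebindX`, every other field verbatim —
robust to the field list of `Provisos₁₂`).
[cite: Balaban1988Convergent, (2.23)–(2.42) pp.259–262 (bookkeeping)] -/
theorem Stage12Params.Provisos₁₂.rebindX {θ : Stage12Params F N} (h : θ.Provisos₁₂ F N) (X' : B12.RunParams → PrintedCarriersR) : (θ.rebindX F N X').Provisos₁₂ F N :=
  { h with base := h.base.rebindX X' }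

/-- The Stage-12 provisos read no carrier: they transport along the [B10] pin … [cite: Balaban1988Convergent, (3.2)–(3.9) pp.265–266, (2.23)–(2.42) pp.259–262 (bookkeeping)] -/
theorem Stage12Params.Provisos₁₂.pinB10 {θ : Stage12Params F N} (h : θ.Provisos₁₂ F N) : (θ.pinB10 F N).Provisos₁₂ F N :=
  { h with base := h.base.pinB10 }

/-- … along the Y pin … [cite: Balaban1988Convergent, (3.2)–(3.9) pp.265–266 (bookkeeping)] -/
theorem Stage12Params.Provisos₁₂.pinY {θ : Stage12Params F N} (h : θ.Provisos₁₂ F N) (Y₀ : PrintedCarriers9X) : (θ.pinY F N Y₀).Provisos₁₂ F N :=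
  { h with base := h.base.pinY Y₀ }

/-- … along the Z pin … [cite: Balaban1988Convergent, (3.2)–(3.9) pp.265–266 (bookkeeping)] -/
theorem Stage12Params.Provisos₁₂.pinZ {θ : Stage12Params F N} (h : θ.Provisos₁₂ F N) (Z₀ : PrintedCarriers11) : (θ.pinZ F N Z₀).Provisos₁₂ F N :=
  { h with base := h.base.pinZ Z₀ }

/-- … along the W pin … [cite: Balaban1988Convergent, (3.2)–(3.9) pp.265–266 (bookkeeping)] -/
theorem Stage12Params.Provisos₁₂.pinW {θ : Stage12Params F N} (h : θ.Provisos₁₂ F N) (W₀ : B12.RunParams → PrintedCarriers15) : (θ.pinW F N W₀).Provisos₁₂ F N :=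
  { h with base := h.base.pinW W₀ }

/-- … and along the [B8] pin. [cite: Balaban1988Convergent, (3.2)–(3.9) pp.265–266 (bookkeeping)] -/
theorem Stage12Params.Provisos₁₂.pinB8 {θ : Stage12Params F N} (h : θ.Provisos₁₂ F N) (lam : ResidB8 θ.toStage3Params) : (θ.pinB8 F N lam).Provisos₁₂ F N :=
  { h with base := h.base.pinB8 lam }

variable (F N)

/-- THE DATUM DOES NOT READ THE CARRIER BUNDLE `X` (`rfl`, once, at a generic re-binding). [cite: Balaban1989LargeFieldII, Thm 1 + (0.1) pp.355–356 (bookkeeping)] -/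
theorem datumOfRecord₁₂_rebindX (θ : Stage12Params F N) (h : θ.Provisos₁₂ F N) (X' : B12.RunParams → PrintedCarriersR) (h' : (θ.rebindX F N X').Provisos₁₂ F N) :
    datumOfRecord₁₂ F N (θ.rebindX F N X') h' = datumOfRecord₁₂ F N θ h := rfl

/-- THE PINS ARE UP-SIDE at Stage 12: the datum of record is unchanged by the [B10] pin (`rfl`) … [cite: Balaban1989LargeFieldII, Thm 1 + (0.1) pp.355–356 (bookkeeping)] -/
theorem datumOfRecord₁₂_pinB10 (θ : Stage12Params F N) (h : θ.Provisos₁₂ F N) : datumOfRecord₁₂ F N (θ.pinB10 F N) h.pinB10 = datumOfRecord₁₂ F N θ h :=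
  datumOfRecord₁₂_rebindX F N θ h _ h.pinB10

/-- … Y (`rfl`) … [cite: Balaban1989LargeFieldII, Thm 1 + (0.1) pp.355–356 (bookkeeping)] -/
theorem datumOfRecord₁₂_pinY (θ : Stage12Params F N) (h : θ.Provisos₁₂ F N) (Y₀ : PrintedCarriers9X) :
    datumOfRecord₁₂ F N (θ.pinY F N Y₀) (h.pinY Y₀) = datumOfRecord₁₂ F N θ h := rfl

/-- … Z (`rfl`) … [cite: Balaban1989LargeFieldII, Thm 1 + (0.1) pp.355–356 (bookkeeping)] -/
theorem datumOfRecord₁₂_pinZ (θ : Stage12Params F N) (h : θ.Provisos₁₂ F N) (Z₀ : PrintedCarriers11) :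
    datumOfRecord₁₂ F N (θ.pinZ F N Z₀) (h.pinZ Z₀) = datumOfRecord₁₂ F N θ h := rfl

/-- … W (`rfl`) … [cite: Balaban1989LargeFieldII, Thm 1 + (0.1) pp.355–356 (bookkeeping)] -/
theorem datumOfRecord₁₂_pinW (θ : Stage12Params F N) (h : θ.Provisos₁₂ F N) (W₀ : B12.RunParams → PrintedCarriers15) :
    datumOfRecord₁₂ F N (θ.pinW F N W₀) (h.pinW W₀) = datumOfRecord₁₂ F N θ h := rfl

/-- … and [B8] (`rfl`). [cite: Balaban1989LargeFieldII, Thm 1 + (0.1) pp.355–356 (bookkeeping)] -/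
theorem datumOfRecord₁₂_pinB8 (θ : Stage12Params F N) (h : θ.Provisos₁₂ F N) (lam : ResidB8 θ.toStage3Params) :
    datumOfRecord₁₂ F N (θ.pinB8 F N lam) (h.pinB8 lam) = datumOfRecord₁₂ F N θ h :=
  datumOfRecord₁₂_rebindX F N θ h _ (h.pinB8 lam)

/-- **The frame of Lemma 4 of record AT A STAGE-12 PARAMETER** for the run `p` (11b's residual recipes `θ.Rz p.K`, `O(1)LMB := θ.s2.cB`, cube size `θ.τ9.M` — the same
fields the Stage-11 view `θ.toStage11 p′` carries, `F12OfRecord₁₂_toStage11 : rfl`). [cite: Balaban1987RG1, Lemma 4 (3.53) p.280, (1.11)–(1.16) p.262] -/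
def F12OfRecord₁₂ (θ : Stage12Params F N) (lam : ResidB12 F N θ.τ9.M) (p : B12.RunParams) : B12Sec2to5.Lemma4Frame :=
  F12OfRecord (θ.Rz p.K) θ.s2.cB (lam p)

/-- **The `b12` leaf at the group of record AT A STAGE-12 PARAMETER**, run `p`. [cite: Balaban1987RG1, Lemma 4 (3.53) p.280] -/
def B12LeafOfRecord₁₂ (θ : Stage12Params F N) (lam : ResidB12 F N θ.τ9.M) (p : B12.RunParams) : Prop :=
  B12LeafOfRecord (θ.Rz p.K) θ.s2.cB (lam p)

/-- The Stage-12 frame ∕ leaf of record IS the Stage-11 one at every view `θ.toStage11 p′` (`rfl` ×2: the view keeps `Rz`, `s2`, `τ9`).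
[cite: Balaban1987RG1, Lemma 4 (3.53) p.280 (bookkeeping)] -/
theorem F12OfRecord₁₂_toStage11 (θ : Stage12Params F N) (lam : ResidB12 F N θ.τ9.M) (p p' : B12.RunParams) :
    F12OfRecord₁₁ F N (θ.toStage11 F N p') lam p = F12OfRecord₁₂ F N θ lam p ∧ (B12LeafOfRecord₁₁ F N (θ.toStage11 F N p') lam p ↔ B12LeafOfRecord₁₂ F N θ lam p) :=
  ⟨rfl, Iff.rfl⟩

/-- The run-indexed carrier bundle with its [B12] group := the group of record (Stage 12). [cite: Balaban1987RG1, Lemma 4 p.280 (objects of record)] -/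
def XB12OfRecord₁₂ (θ : Stage12Params F N) (lam : ResidB12 F N θ.τ9.M) (X : B12.RunParams → PrintedCarriersR) : B12.RunParams → PrintedCarriersR :=
  fun p => (X p).withB12 (F12OfRecord₁₂ F N θ lam p) (lam p).consts

/-- **The [B12] pin of Stage-12 parameters** (`X`-re-binding; `Rz`, `s2`, `τ9`, `Zt` kept). [cite: Balaban1987RG1, Lemma 4 p.280 (objects of record, Stage 3′(X.B12))] -/
def Stage12Params.pinB12 (θ : Stage12Params F N) (lam : ResidB12 F N θ.τ9.M) : Stage12Params F N :=
  θ.rebindX F N (XB12OfRecord₁₂ F N θ lam θ.res.X)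

/-- **The [B8′] pin of Stage-12 parameters** (`X`-re-binding over g32's `withB8OfRecordSub`). [cite: Balaban1985RegularSpaces, Thm 2 p.83 (objects of record, Stage 3′(X.B8′))] -/
def Stage12Params.pinB8Sub (θ : Stage12Params F N) (lam : ResidB8 θ.toStage3Params) : Stage12Params F N :=
  θ.rebindX F N fun P => (θ.res.X P).withB8OfRecordSub θ.toStage3Params lam

/-- The [B12]-pinned carrier family, unfolded (`rfl`). [cite: Balaban1987RG1, Lemma 4 p.280 (bookkeeping)] -/
theorem Stage12Params.pinB12_X (θ : Stage12Params F N) (lam : ResidB12 F N θ.τ9.M) (p : B12.RunParams) :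
    (θ.pinB12 F N lam).res.X p = (θ.res.X p).withB12 (F12OfRecord₁₂ F N θ lam p) (lam p).consts := rfl

/-- The [B8′]-pinned carrier family, unfolded (`rfl`). [cite: Balaban1985RegularSpaces, Lemma 1 – Thm 8 pp.79–101 (bookkeeping)] -/
theorem Stage12Params.pinB8Sub_X (θ : Stage12Params F N) (lam : ResidB8 θ.toStage3Params) (P : B12.RunParams) :
    (θ.pinB8Sub F N lam).res.X P = (θ.res.X P).withB8OfRecordSub θ.toStage3Params lam := rfl

/-- Admissibility is unchanged by the [B12] pin (`Iff.rfl`) … [cite: Balaban1987RG1, (1.12) p.262 (bookkeeping)] -/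
theorem Stage12Params.pinB12_admissible_iff (θ : Stage12Params F N) (lam : ResidB12 F N θ.τ9.M) : (θ.pinB12 F N lam).Admissible F N ↔ θ.Admissible F N := Iff.rfl

/-- … and by the [B8′] pin (`Iff.rfl`). [cite: Balaban1983RegularityDecay, (1.6) p.572 (bookkeeping)] -/
theorem Stage12Params.pinB8Sub_admissible_iff (θ : Stage12Params F N) (lam : ResidB8 θ.toStage3Params) : (θ.pinB8Sub F N lam).Admissible F N ↔ θ.Admissible F N :=
  Iff.rfl

/-- The [B12] pin keeps the Stage-3 dictionary and the frame of record itself (`rfl` ×2). [cite: Balaban1987RG1, (1.11)–(1.16) p.262 (bookkeeping)] -/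
theorem F12OfRecord₁₂_pinB12 (θ : Stage12Params F N) (lam lam' : ResidB12 F N θ.τ9.M) (p : B12.RunParams) :
    (θ.pinB12 F N lam').toStage3Params = θ.toStage3Params ∧ F12OfRecord₁₂ F N (θ.pinB12 F N lam') lam p = F12OfRecord₁₂ F N θ lam p := ⟨rfl, rfl⟩

/-- The [B8′] pin keeps the Stage-3 dictionary and the [B12] frame of record (`rfl` ×2). [cite: Balaban1987RG1, Lemma 4 p.280 (bookkeeping)] -/
theorem F12OfRecord₁₂_pinB8Sub (θ : Stage12Params F N) (lam8 : ResidB8 θ.toStage3Params) (lam : ResidB12 F N θ.τ9.M) (p : B12.RunParams) :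
    (θ.pinB8Sub F N lam8).toStage3Params = θ.toStage3Params ∧ F12OfRecord₁₂ F N (θ.pinB8Sub F N lam8) lam p = F12OfRecord₁₂ F N θ lam p := ⟨rfl, rfl⟩

/-- The Stage-12 view of [B12]- ∕ [B8′]-pinned parameters IS the re-bound Stage-12 view (`rfl` ×2, through `toStage5₁₂_rebindX`). [cite: Balaban1988Convergent, p.244 (bookkeeping)] -/
theorem Stage12Params.toStage5₁₂_pinB12_pinB8Sub (θ : Stage12Params F N) (lam : ResidB12 F N θ.τ9.M) (lam8 : ResidB8 θ.toStage3Params) :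
    (θ.pinB12 F N lam).toStage5₁₂ F N = (θ.toStage5₁₂ F N).rebindX F N (XB12OfRecord₁₂ F N θ lam θ.res.X) ∧
    (θ.pinB8Sub F N lam8).toStage5₁₂ F N = (θ.toStage5₁₂ F N).rebindX F N (fun P => (θ.res.X P).withB8OfRecordSub θ.toStage3Params lam8) :=
  ⟨Stage12Params.toStage5₁₂_rebindX F N θ _, Stage12Params.toStage5₁₂_rebindX F N θ _⟩

variable {F N} in
/-- The Stage-12 provisos transport along the [B12] and [B8′] pins. [cite: Balaban1988Convergent, (2.23)–(2.42) pp.259–262 (bookkeeping)] -/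
theorem Stage12Params.Provisos₁₂.pinB12 {θ : Stage12Params F N} (h : θ.Provisos₁₂ F N) (lam : ResidB12 F N θ.τ9.M) : (θ.pinB12 F N lam).Provisos₁₂ F N :=
  h.rebindX _

variable {F N} in
/-- … [cite: Balaban1988Convergent, (2.23)–(2.42) pp.259–262 (bookkeeping)] -/
theorem Stage12Params.Provisos₁₂.pinB8Sub {θ : Stage12Params F N} (h : θ.Provisos₁₂ F N) (lam : ResidB8 θ.toStage3Params) : (θ.pinB8Sub F N lam).Provisos₁₂ F N :=
  h.rebindX _

/-- UP-SIDE: the datum of record is unchanged by the [B12] pin (`rfl`) … [cite: Balaban1989LargeFieldII, Thm 1 + (0.1) pp.355–356 (bookkeeping)] -/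
theorem datumOfRecord₁₂_pinB12 (θ : Stage12Params F N) (h : θ.Provisos₁₂ F N) (lam : ResidB12 F N θ.τ9.M) :
    datumOfRecord₁₂ F N (θ.pinB12 F N lam) (h.pinB12 lam) = datumOfRecord₁₂ F N θ h :=
  datumOfRecord₁₂_rebindX F N θ h _ (h.pinB12 lam)

/-- … and by the [B8′] pin (`rfl`). [cite: Balaban1989LargeFieldII, Thm 1 + (0.1) pp.355–356 (bookkeeping)] -/
theorem datumOfRecord₁₂_pinB8Sub (θ : Stage12Params F N) (h : θ.Provisos₁₂ F N) (lam : ResidB8 θ.toStage3Params) :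
    datumOfRecord₁₂ F N (θ.pinB8Sub F N lam) (h.pinB8Sub lam) = datumOfRecord₁₂ F N θ h :=
  datumOfRecord₁₂_rebindX F N θ h _ (h.pinB8Sub lam)

/-- `WOfRecord₁₂` does not read the [B12]- ∕ [B8′]-pinned fields (`rfl` ×2). [cite: Balaban1989LargeFieldI, (0.2) p.176 (bookkeeping)] -/
theorem WOfRecord₁₂_pinB12_pinB8Sub (θ : Stage12Params F N) (lam : ResidB12 F N θ.τ9.M) (lam8 : ResidB8 θ.toStage3Params) (lamW : ResidW F N) :
    WOfRecord₁₂ F N (θ.pinB12 F N lam) lamW = WOfRecord₁₂ F N θ lamW ∧ WOfRecord₁₂ F N (θ.pinB8Sub F N lam8) lamW = WOfRecord₁₂ F N θ lamW := ⟨rfl, rfl⟩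

/-- **The cumulative four-pin Stage-12 view**: `θ.toStage5₁₂` pinned by `pinB10`, then `pinY (Y9OfRecord …)`, then `pinZ (Z11OfRecord F N ζ)`, then `pinW (WOfRecord₁₂ θ lamW)`.
[cite: Balaban1985UV3, Thm 1 p.257; Balaban1985BackgroundPropagators, Thm 3.1 p.397; Balaban1985Variational, Thm 1 p.279; Balaban1989LargeFieldI, (0.2) p.176 (objects of record)] -/
def Stage12Params.view₁₂B10YZW (θ : Stage12Params F N) (Mstar : ℕ) (ops : OpsY N θ.toStage3Params Mstar) (ζ : ResidZ F N) (lamW : ResidW F N) :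
    Stage5Params F N :=
  ((((θ.toStage5₁₂ F N).pinB10 F N).pinY F N (Y9OfRecord N θ.toStage3Params Mstar ops)).pinZ F N (Z11OfRecord F N ζ)).pinW F N (WOfRecord₁₂ F N θ lamW)

/-- The four-pin view IS the Stage-12 view of the QUADRUPLY PINNED parameters (composed from the single-pin `rfl`s). [cite: Balaban1989LargeFieldII, Thm 1 p.355 (bookkeeping)] -/
theorem Stage12Params.view₁₂B10YZW_eq (θ : Stage12Params F N) (Mstar : ℕ) (ops : OpsY N θ.toStage3Params Mstar) (ζ : ResidZ F N) (lamW : ResidW F N) :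
    θ.view₁₂B10YZW F N Mstar ops ζ lamW =
      ((((θ.pinB10 F N).pinY F N (Y9OfRecord N θ.toStage3Params Mstar ops)).pinZ F N (Z11OfRecord F N ζ)).pinW F N (WOfRecord₁₂ F N θ lamW)).toStage5₁₂ F N := by
  rw [Stage12Params.toStage5₁₂_pinW, Stage12Params.toStage5₁₂_pinZ, Stage12Params.toStage5₁₂_pinY, Stage12Params.toStage5₁₂_pinB10]
  rfl

/-- The leaves of the C-binding over the four-pin view, by name. [cite: Balaban1989LargeFieldI, Prop. 1 p.194; Balaban1985Variational, Thm 1 p.279; Balaban1985BackgroundPropagators, Thm 3.1 p.397; Balaban1985UV3, Thm 1 p.257 + Thm 2 p.272] -/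
theorem upOfRecord₅C_view₁₂B10YZW_leaves (θ : Stage12Params F N) (Mstar : ℕ) (ops : OpsY N θ.toStage3Params Mstar) (ζ : ResidZ F N) (lamW : ResidW F N) (P : B12.RunParams) :
    ((upOfRecord₅C F N (θ.view₁₂B10YZW F N Mstar ops ζ lamW) P).rBasicStep ↔ B15Leaf (WOfRecord₁₂ F N θ lamW P)) ∧
    ((upOfRecord₅C F N (θ.view₁₂B10YZW F N Mstar ops ζ lamW) P).b9 ↔ B9LeafX (Y9OfRecord N θ.toStage3Params Mstar ops)) ∧
    ((upOfRecord₅C F N (θ.view₁₂B10YZW F N Mstar ops ζ lamW) P).b10 ↔ PrintedUV3V N θ.L) ∧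
    ((upOfRecord₅C F N (θ.view₁₂B10YZW F N Mstar ops ζ lamW) P).b11 ↔ B11Leaf (Z11OfRecord F N ζ)) := by
  have hw := upOfRecord₅C_pinW_b9_b10_b11 F N ((((θ.toStage5₁₂ F N).pinB10 F N).pinY F N (Y9OfRecord N θ.toStage3Params Mstar ops)).pinZ F N (Z11OfRecord F N ζ))
    (WOfRecord₁₂ F N θ lamW) P
  refine ⟨upOfRecord₅C_pinW_rBasicStep_iff F N _ _ P, ?_, ?_, ?_⟩
  · unfold Stage12Params.view₁₂B10YZW
    rw [hw.1, upOfRecord₅C_pinZ_b9]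
    exact upOfRecord₅C_pinY_b9_iff F N _ _ P
  · unfold Stage12Params.view₁₂B10YZW
    rw [hw.2.1, upOfRecord₅C_pinZ_b10, upOfRecord₅C_pinY_b10]
    exact upOfRecord₅C_pinB10_b10_iff F N (θ.toStage5₁₂ F N) P
  · unfold Stage12Params.view₁₂B10YZW
    rw [hw.2.2]
    exact upOfRecord₅C_pinZ_b11_iff F N _ _ P

/-- **The five-pin Stage-12 view with [B8]** ([B8] innermost). [cite: Balaban1985RegularSpaces, Thm 2 p.83 (objects of record)] -/
def Stage12Params.view₁₂B8B10YZW (θ : Stage12Params F N) (lam : ResidB8 θ.toStage3Params) (Mstar : ℕ) (ops : OpsY N θ.toStage3Params Mstar) (ζ : ResidZ F N)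
    (lamW : ResidW F N) : Stage5Params F N :=
  (θ.pinB8 F N lam).view₁₂B10YZW F N Mstar ops ζ lamW

/-- The leaves of the S-binding over the five-pin view, by name (`b8` is `Iff.rfl`; the other four are the four-pin faces at `θ.pinB8 lam`).
[cite: Balaban1985RegularSpaces, Lemma 1 – Thm 8 pp.79–101; Balaban1989LargeFieldI, Prop. 1 p.194; Balaban1985BackgroundPropagators, Thm 3.1 p.397; Balaban1985UV3, Thm 1 p.257; Balaban1985Variational, Thm 1 p.279] -/
theorem upOfRecord₅CS_view₁₂B8B10YZW_leaves (θ : Stage12Params F N) (lam : ResidB8 θ.toStage3Params) (Mstar : ℕ) (ops : OpsY N θ.toStage3Params Mstar)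
    (ζ : ResidZ F N) (lamW : ResidW F N) (P : B12.RunParams) :
    ((upOfRecord₅CS F N (θ.view₁₂B8B10YZW F N lam Mstar ops ζ lamW) P).b8 ↔ B8LeafOfRecord θ.toStage3Params lam) ∧
    ((upOfRecord₅CS F N (θ.view₁₂B8B10YZW F N lam Mstar ops ζ lamW) P).rBasicStep ↔ B15Leaf (WOfRecord₁₂ F N θ lamW P)) ∧
    ((upOfRecord₅CS F N (θ.view₁₂B8B10YZW F N lam Mstar ops ζ lamW) P).b9 ↔ B9LeafX (Y9OfRecord N θ.toStage3Params Mstar ops)) ∧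
    ((upOfRecord₅CS F N (θ.view₁₂B8B10YZW F N lam Mstar ops ζ lamW) P).b10 ↔ PrintedUV3V N θ.L) ∧
    ((upOfRecord₅CS F N (θ.view₁₂B8B10YZW F N lam Mstar ops ζ lamW) P).b11 ↔ B11Leaf (Z11OfRecord F N ζ)) :=
  ⟨Iff.rfl, upOfRecord₅C_view₁₂B10YZW_leaves F N (θ.pinB8 F N lam) Mstar ops ζ lamW P⟩

/-- … and the C-binding's `b8` over the five-pin view is the leaf AS TYPED at the group of record (`Iff.rfl`). [cite: Balaban1985RegularSpaces, Lemma 1 – Thm 8 pp.79–101 (bookkeeping)] -/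
theorem upOfRecord₅C_view₁₂B8B10YZW_b8_iff (θ : Stage12Params F N) (lam : ResidB8 θ.toStage3Params) (Mstar : ℕ) (ops : OpsY N θ.toStage3Params Mstar)
    (ζ : ResidZ F N) (lamW : ResidW F N) (P : B12.RunParams) :
    (upOfRecord₅C F N (θ.view₁₂B8B10YZW F N lam Mstar ops ζ lamW) P).b8 ↔
      B8LeafR θ.D (θ.L : ℝ) lam.C₂ lam.B₁' lam.inp.B₀' lam.B₁ lam.B₂ lam.c₁ lam.inp lam.B₀β (B8Lemma1NonAbelian.blockPairNA θ.D θ.L θ.𝔸)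
        (famB8OfRecord θ.toStage3Params lam.β lam.len) lam.lan lam.cub lam.toAxial :=
  Iff.rfl


/-- **The six-pin Stage-12 view** ([B12] innermost, then the five-pin view with [B8]). [cite: Balaban1987RG1, Lemma 4 p.280; Balaban1985RegularSpaces, Thm 2 p.83 (objects of record)] -/
def Stage12Params.view₁₂B12B8B10YZW (θ : Stage12Params F N) (lam12 : ResidB12 F N θ.τ9.M) (lam : ResidB8 θ.toStage3Params) (Mstar : ℕ)
    (ops : OpsY N θ.toStage3Params Mstar) (ζ : ResidZ F N) (lamW : ResidW F N) : Stage5Params F N :=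
  (θ.pinB12 F N lam12).view₁₂B8B10YZW F N lam Mstar ops ζ lamW

/-- **The five-pin Stage-12 view with [B8′]** ([B8′] innermost). [cite: Balaban1985RegularSpaces, Thm 2 p.83 (objects of record)] -/
def Stage12Params.view₁₂B8subB10YZW (θ : Stage12Params F N) (lam : ResidB8 θ.toStage3Params) (Mstar : ℕ) (ops : OpsY N θ.toStage3Params Mstar) (ζ : ResidZ F N)
    (lamW : ResidW F N) : Stage5Params F N :=
  (θ.pinB8Sub F N lam).view₁₂B10YZW F N Mstar ops ζ lamW

/-- **The six-pin Stage-12 view with [B12] and [B8′]** ([B12] innermost). [cite: Balaban1987RG1, Lemma 4 p.280; Balaban1985RegularSpaces, Thm 2 p.83 (objects of record)] -/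
def Stage12Params.view₁₂B12B8subB10YZW (θ : Stage12Params F N) (lam12 : ResidB12 F N θ.τ9.M) (lam : ResidB8 θ.toStage3Params) (Mstar : ℕ)
    (ops : OpsY N θ.toStage3Params Mstar) (ζ : ResidZ F N) (lamW : ResidW F N) : Stage5Params F N :=
  (θ.pinB12 F N lam12).view₁₂B8subB10YZW F N lam Mstar ops ζ lamW

/-- **THE SIX LEAVES OF THE S-BINDING OVER THE SIX-PIN VIEW**, by name (`b12`, `b8` by `Iff.rfl`). [cite: Balaban1987RG1, Lemma 4 p.280; Balaban1985RegularSpaces, Lemma 1 – Thm 8 pp.79–101; Balaban1989LargeFieldI, Prop. 1 p.194; Balaban1985BackgroundPropagators, Thm 3.1 p.397; Balaban1985UV3, Thm 1 p.257; Balaban1985Variational, Thm 1 p.279] -/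
theorem upOfRecord₅CS_view₁₂B12B8B10YZW_leaves (θ : Stage12Params F N) (lam12 : ResidB12 F N θ.τ9.M) (lam : ResidB8 θ.toStage3Params) (Mstar : ℕ)
    (ops : OpsY N θ.toStage3Params Mstar) (ζ : ResidZ F N) (lamW : ResidW F N) (P : B12.RunParams) :
    ((upOfRecord₅CS F N (θ.view₁₂B12B8B10YZW F N lam12 lam Mstar ops ζ lamW) P).b12 ↔ B12LeafOfRecord₁₂ F N θ lam12 P) ∧
    ((upOfRecord₅CS F N (θ.view₁₂B12B8B10YZW F N lam12 lam Mstar ops ζ lamW) P).b8 ↔ B8LeafOfRecord θ.toStage3Params lam) ∧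
    ((upOfRecord₅CS F N (θ.view₁₂B12B8B10YZW F N lam12 lam Mstar ops ζ lamW) P).rBasicStep ↔ B15Leaf (WOfRecord₁₂ F N θ lamW P)) ∧
    ((upOfRecord₅CS F N (θ.view₁₂B12B8B10YZW F N lam12 lam Mstar ops ζ lamW) P).b9 ↔ B9LeafX (Y9OfRecord N θ.toStage3Params Mstar ops)) ∧
    ((upOfRecord₅CS F N (θ.view₁₂B12B8B10YZW F N lam12 lam Mstar ops ζ lamW) P).b10 ↔ PrintedUV3V N θ.L) ∧
    ((upOfRecord₅CS F N (θ.view₁₂B12B8B10YZW F N lam12 lam Mstar ops ζ lamW) P).b11 ↔ B11Leaf (Z11OfRecord F N ζ)) :=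
  ⟨Iff.rfl, upOfRecord₅CS_view₁₂B8B10YZW_leaves F N (θ.pinB12 F N lam12) lam Mstar ops ζ lamW P⟩

/-- The leaves of the S-binding over the five-pin view with [B8′], by name (`b8` is `Iff.rfl`). [cite: Balaban1985RegularSpaces, Lemma 1 – Thm 8 pp.79–101; Balaban1989LargeFieldI, Prop. 1 p.194; Balaban1985BackgroundPropagators, Thm 3.1 p.397; Balaban1985UV3, Thm 1 p.257; Balaban1985Variational, Thm 1 p.279] -/
theorem upOfRecord₅CS_view₁₂B8subB10YZW_leaves (θ : Stage12Params F N) (lam : ResidB8 θ.toStage3Params) (Mstar : ℕ) (ops : OpsY N θ.toStage3Params Mstar)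
    (ζ : ResidZ F N) (lamW : ResidW F N) (P : B12.RunParams) :
    ((upOfRecord₅CS F N (θ.view₁₂B8subB10YZW F N lam Mstar ops ζ lamW) P).b8 ↔ B8LeafOfRecordSub θ.toStage3Params lam) ∧
    ((upOfRecord₅CS F N (θ.view₁₂B8subB10YZW F N lam Mstar ops ζ lamW) P).rBasicStep ↔ B15Leaf (WOfRecord₁₂ F N θ lamW P)) ∧
    ((upOfRecord₅CS F N (θ.view₁₂B8subB10YZW F N lam Mstar ops ζ lamW) P).b9 ↔ B9LeafX (Y9OfRecord N θ.toStage3Params Mstar ops)) ∧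
    ((upOfRecord₅CS F N (θ.view₁₂B8subB10YZW F N lam Mstar ops ζ lamW) P).b10 ↔ PrintedUV3V N θ.L) ∧
    ((upOfRecord₅CS F N (θ.view₁₂B8subB10YZW F N lam Mstar ops ζ lamW) P).b11 ↔ B11Leaf (Z11OfRecord F N ζ)) :=
  ⟨Iff.rfl, upOfRecord₅C_view₁₂B10YZW_leaves F N (θ.pinB8Sub F N lam) Mstar ops ζ lamW P⟩

/-- … and the C-binding's `b8` over it is the leaf AS TYPED at the re-keyed group of record (`Iff.rfl`). [cite: Balaban1985RegularSpaces, Lemma 1 – Thm 8 pp.79–101 (bookkeeping)] -/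
theorem upOfRecord₅C_view₁₂B8subB10YZW_b8_iff (θ : Stage12Params F N) (lam : ResidB8 θ.toStage3Params) (Mstar : ℕ) (ops : OpsY N θ.toStage3Params Mstar)
    (ζ : ResidZ F N) (lamW : ResidW F N) (P : B12.RunParams) :
    (upOfRecord₅C F N (θ.view₁₂B8subB10YZW F N lam Mstar ops ζ lamW) P).b8 ↔
      B8LeafR θ.D (θ.L : ℝ) lam.C₂ lam.B₁' lam.inp.B₀' lam.B₁ lam.B₂ lam.c₁ lam.inp lam.B₀β (B8Lemma1NonAbelian.blockPairNA θ.D θ.L θ.𝔸)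
        (fun j : IdxB8Sub θ.toStage3Params => famB8OfRecord θ.toStage3Params lam.β lam.len j.1) lam.lan lam.cub (fun j => lam.toAxial j.1) :=
  Iff.rfl

/-- **THE SIX LEAVES OF THE S-BINDING OVER THE SIX-PIN VIEW WITH [B8′]**, by name (`b12`, `b8` by `Iff.rfl`). [cite: Balaban1987RG1, Lemma 4 p.280; Balaban1985RegularSpaces, Lemma 1 – Thm 8 pp.79–101; Balaban1989LargeFieldI, Prop. 1 p.194; Balaban1985BackgroundPropagators, Thm 3.1 p.397; Balaban1985UV3, Thm 1 p.257; Balaban1985Variational, Thm 1 p.279] -/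
theorem upOfRecord₅CS_view₁₂B12B8subB10YZW_leaves (θ : Stage12Params F N) (lam12 : ResidB12 F N θ.τ9.M) (lam : ResidB8 θ.toStage3Params) (Mstar : ℕ)
    (ops : OpsY N θ.toStage3Params Mstar) (ζ : ResidZ F N) (lamW : ResidW F N) (P : B12.RunParams) :
    ((upOfRecord₅CS F N (θ.view₁₂B12B8subB10YZW F N lam12 lam Mstar ops ζ lamW) P).b12 ↔ B12LeafOfRecord₁₂ F N θ lam12 P) ∧
    ((upOfRecord₅CS F N (θ.view₁₂B12B8subB10YZW F N lam12 lam Mstar ops ζ lamW) P).b8 ↔ B8LeafOfRecordSub θ.toStage3Params lam) ∧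
    ((upOfRecord₅CS F N (θ.view₁₂B12B8subB10YZW F N lam12 lam Mstar ops ζ lamW) P).rBasicStep ↔ B15Leaf (WOfRecord₁₂ F N θ lamW P)) ∧
    ((upOfRecord₅CS F N (θ.view₁₂B12B8subB10YZW F N lam12 lam Mstar ops ζ lamW) P).b9 ↔ B9LeafX (Y9OfRecord N θ.toStage3Params Mstar ops)) ∧
    ((upOfRecord₅CS F N (θ.view₁₂B12B8subB10YZW F N lam12 lam Mstar ops ζ lamW) P).b10 ↔ PrintedUV3V N θ.L) ∧
    ((upOfRecord₅CS F N (θ.view₁₂B12B8subB10YZW F N lam12 lam Mstar ops ζ lamW) P).b11 ↔ B11Leaf (Z11OfRecord F N ζ)) :=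
  ⟨Iff.rfl, upOfRecord₅CS_view₁₂B8subB10YZW_leaves F N (θ.pinB12 F N lam12) lam Mstar ops ζ lamW P⟩

end Pins

end Literature.MathematicalPhysics.QuantumFieldTheory.Balaban1983to89.Node00

end
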